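import Mathlib.Tactic.Sat.FromLRAT
import Mathlib.Data.List.Basic
import Mathlib.Data.List.GetD
import Mathlib.Data.List.Range
import Mathlib.Data.List.TakeDrop

/-!
# MM22 venture — `ProfileSAT` (1/4): a kernel bridge from Mathlib's `lrat_proof` to finite «choose k of n within row caps» problems

HONEST FRAMING (cell `pub-mm22`, seat engine-2 g3; v4 item (0″) «LRAT route», generic layer). This file and its three
siblings (`ProfileSATBlocks`, `ProfileSATCounter`, `ProfileSATEncode`) are PLUMBING: here a CNF datatype with Boolean
semantics, a Lean mirror of the propositional statement produced by Mathlib's `lrat_proof` / `from_lrat`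
(`Mathlib.Tactic.Sat.FromLRAT`) and the soundness of that mirror; in the siblings a verified CNF ENCODER for instances «exactly `k` of the variables `0 … n-1` are true and, for each row `(members, cap)`, at most
`cap` of the listed variables are true» (direct no-goods for small rows, Sinz sequential counters otherwise).
Main theorem: `Inst.not_sol_of_propUnsat` — if the encoded CNF is refuted (a theorem of the mirrored shape, which is
exactly what `from_lrat "<cnf>" "<lrat>"` proves), the instance has no solution. Nothing here mentions matrices or
tensors; the dictionary «instance ↔ sub-case of the M2-split of the root profile question for ⟨3,3,3⟩ over 𝔽₂» is the
business of the files that use this one. No bound on any rank is proved here.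

Design notes. (1) We never refer to the auxiliary declarations `<name>.ctx_i` / `<name>.proof_i` that `lrat_proof`
creates (their names are private and carry unstable indices); instead the data file instantiates the produced theorem
`foo : ∀ (a_0 … a_{nv-1} : Prop), E` at `a_i := x i` for a function binder `x : ℕ → Prop`, and `E[x]` is
*definitionally* `CT.reify x (CT.ofList f)` where `f` is OUR clause list: `CT.ofList` rebuilds the balanced `∨`-tree
that `buildReify` produces (split at `len / 2`, right-nested `∧` inside a clause, `Literal.pos v ↦ ¬ x v`,
`Literal.neg v ↦ x v`). Measured: 2,197 variables / 21,142 clauses convert and replay in 79 s on the Lean farm.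
(2) All definitions are structurally recursive and list-based so that this conversion (elaborator AND kernel) can unfold
them; the DIMACS text handed to `lrat_proof` is rendered from the same Lean data (`CNF.dimacs`, evaluated at
elaboration time only), so the CNF is never duplicated in a data file.
(3) The encoder (`Inst.encode`): cardinality «exactly k» by a Sinz sequential counter, each row «at most cap» by direct
no-goods when there are at most `directLimit` of them and by a sequential counter otherwise; `Inst.encode_complete`
proves that every solution extends to a model, hence a kernel-replayed refutation gives `∀ x, ¬ I.Sol x`
(`Inst.not_sol_of_propUnsat`). A Python mirror of the encoder (engine-2 g3, `psenc.py`) produces the byte-identical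
DIMACS for the SAT solver; any mismatch would make the replay fail, never succeed wrongly.
-/

namespace Summit.Ventures.MM22.ProfileSAT

/-! ## 1. CNF syntax and Boolean semantics -/

/-- A literal over ℕ-indexed propositional variables (0-based; DIMACS variable `v+1`):
`pos v` is «variable `v` is true», `neg v` is «variable `v` is false». -/
inductive Lit
  /-- positive literal -/
  | pos (v : ℕ)
  /-- negative literal -/
  | neg (v : ℕ)
  deriving DecidableEq

/-- The variable of a literal. -/
def Lit.var : Lit → ℕ
  | .pos v => v
  | .neg v => v

/-- Boolean value of a literal under an assignment. -/
def Lit.eval (x : ℕ → Bool) : Lit → Bool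
  | .pos v => x v
  | .neg v => !(x v)

/-- A clause is a list of literals (a disjunction). -/
abbrev Clause := List Lit

/-- A CNF is a list of clauses (a conjunction). -/
abbrev CNF := List Clause

/-- Boolean value of a clause: some literal is true. -/
def Clause.eval (x : ℕ → Bool) (c : Clause) : Bool := c.any (Lit.eval x)

/-- Boolean value of a CNF: every clause is true. -/
def CNF.eval (x : ℕ → Bool) (f : CNF) : Bool := f.all (Clause.eval x)


/-! ## 2. Mirror of the statement produced by `Mathlib.Tactic.Sat.FromLRAT.buildReify`

`lrat_proof foo cnf lrat` proves `foo : ∀ (a_0 … a_{nv-1} : Prop), E` where `E` says «some clause has all its literals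
falsified», built as a BALANCED binary `∨`-tree over the clause array (split at `len / 2`) with right-nested `∧` inside a
clause. Data files therefore store the CNF as the same balanced tree (`CT`, generated off-line), so that
`fun x => foo (x 0) (x 1) … (x (nv-1)) : CT.PropUnsat t` elaborates — and is kernel-checked — by plain structural
unfolding of `CT.reify` (no list surgery). The flat clause list is `CT.toList t` (in-order = DIMACS order). -/

/-- Reified literal under `x : ℕ → Prop`: `pos v ↦ ¬ x v` and `neg v ↦ x v`
(this is `Sat.Literal.reify`: the proposition asserting the literal is FALSIFIED). -/
def Lit.reify (x : ℕ → Prop) : Lit → Prop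
  | .pos v => ¬ x v
  | .neg v => x v

/-- Reified clause: right-nested conjunction of reified literals, the last literal alone, `[] ↦ True`
(this is `Sat.Clause.reify`: «every literal of the clause is falsified»). -/
def Clause.reify (x : ℕ → Prop) : Clause → Prop
  | [] => True
  | [l] => l.reify x
  | l :: c => l.reify x ∧ Clause.reify x c

/-- A CNF stored as a binary tree of clauses (leaves in DIMACS order). -/
inductive CT
  /-- a single clause (`Sat.Fmla.one`) -/
  | one (c : Clause)
  /-- conjunction of two sub-formulas (`Sat.Fmla.and`) -/
  | node (l r : CT)

/-- Reified tree formula: `one c ↦ ⟦c falsified⟧`, `node l r ↦ l ∨ r` (this is `Sat.Fmla.reify`). -/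
def CT.reify (x : ℕ → Prop) : CT → Prop
  | .one c => Clause.reify x c
  | .node l r => CT.reify x l ∨ CT.reify x r

/-- In-order list of clauses (accumulator version). -/
def CT.toListAux : CT → CNF → CNF
  | .one c, acc => c :: acc
  | .node l r, acc => CT.toListAux l (CT.toListAux r acc)

/-- The flat CNF of a clause tree (leaves in order = the DIMACS clause order). -/
def CT.toList (t : CT) : CNF := CT.toListAux t []

/-- Build the balanced clause tree of the first `n` clauses of `l` (shape of Mathlib's `buildConj`: left part
`n / 2` clauses, right part the rest), returning also the unconsumed clauses. `fuel + 1 ≥ n` suffices. -/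
def CT.build : ℕ → ℕ → CNF → CT × CNF
  | 0, _, l => (.one (l.headD []), l.tail)
  | fuel + 1, n, l =>
    if n ≤ 1 then (.one (l.headD []), l.tail)
    else
      match CT.build fuel (n / 2) l with
      | (t1, l1) =>
        match CT.build fuel (n - n / 2) l1 with
        | (t2, l2) => (.node t1 t2, l2)

/-- The balanced clause tree of a (nonempty) CNF, in the shape `lrat_proof` reifies it. -/
def CT.ofList (f : CNF) : CT := (CT.build f.length f.length f).1

/-- Specification of `CT.build`: it consumes exactly the first `n` clauses, in order. -/
theorem CT.build_spec : ∀ (fuel n : ℕ) (l : CNF), 1 ≤ n → n ≤ fuel + 1 → n ≤ l.length →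
    (CT.build fuel n l).2 = l.drop n ∧
      ∀ acc, CT.toListAux (CT.build fuel n l).1 acc = l.take n ++ acc
  | 0, n, l, h1, hf, hl => by
    have hn : n = 1 := by omega
    subst hn
    have hne : l ≠ [] := List.ne_nil_of_length_pos (by omega)
    obtain ⟨c, l', rfl⟩ := List.exists_cons_of_ne_nil hne
    simp [CT.build, CT.toListAux]
  | fuel + 1, n, l, h1, hf, hl => by
    by_cases hn : n ≤ 1
    · have hn1 : n = 1 := by omega
      subst hn1
      have hne : l ≠ [] := List.ne_nil_of_length_pos (by omega)
      obtain ⟨c, l', rfl⟩ := List.exists_cons_of_ne_nil hne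
      simp [CT.build, CT.toListAux]
    · obtain ⟨ih1a, ih1b⟩ := CT.build_spec fuel (n / 2) l (by omega) (by omega) (by omega)
      obtain ⟨ih2a, ih2b⟩ := CT.build_spec fuel (n - n / 2) (l.drop (n / 2)) (by omega) (by omega)
        (by simp only [List.length_drop]; omega)
      rcases e1 : CT.build fuel (n / 2) l with ⟨t1, l1⟩
      rw [e1] at ih1a ih1b
      simp only at ih1a ih1b
      subst ih1a
      rcases e2 : CT.build fuel (n - n / 2) (l.drop (n / 2)) with ⟨t2, l2⟩
      rw [e2] at ih2a ih2b
      simp only at ih2a ih2b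
      subst ih2a
      simp only [CT.build, if_neg hn, e1, e2, List.drop_drop, CT.toListAux]
      refine ⟨by congr 1; omega, fun acc => ?_⟩
      rw [ih1b, ih2b, ← List.append_assoc, ← List.take_add]
      congr 2
      omega

/-- The flat CNF is recovered from its balanced tree. -/
theorem CT.toList_ofList (f : CNF) (hf : f ≠ []) : (CT.ofList f).toList = f := by
  have h1 : 1 ≤ f.length := List.length_pos_of_ne_nil hf
  have := (CT.build_spec f.length f.length f h1 (by omega) le_rfl).2 []
  simpa [CT.ofList, CT.toList] using this

/-- **The mirrored statement**: for every `Prop`-valued assignment some clause of `t` is falsified.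
For the DIMACS rendering of `t.toList` with `nv` variables, `fun x => foo (x 0) … (x (nv-1))` has exactly this type
when `foo` is the theorem produced by `lrat_proof foo …`. -/
def CT.PropUnsat (t : CT) : Prop := ∀ x : ℕ → Prop, CT.reify x t

/-! ## 3. Soundness of the mirror: a refuted clause tree has no Boolean model -/

/-- A reified clause asserts that each of its literals is falsified. -/
theorem Clause.reify_imp {x : ℕ → Prop} : ∀ {c : Clause}, Clause.reify x c → ∀ l ∈ c, l.reify x
  | [], _, l, hl => absurd hl List.not_mem_nil
  | [l0], h, l, hl => by
    rw [List.mem_singleton] at hl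
    subst hl
    exact h
  | l0 :: l1 :: c, h, l, hl => by
    rcases List.mem_cons.1 hl with rfl | hl
    · exact h.1
    · exact Clause.reify_imp h.2 l hl

/-- Membership in the accumulator version of the in-order traversal. -/
theorem CT.mem_toListAux : ∀ (t : CT) (acc : CNF) (c : Clause),
    c ∈ CT.toListAux t acc ↔ c ∈ CT.toListAux t [] ∨ c ∈ acc
  | .one c0, acc, c => by simp [CT.toListAux]
  | .node l r, acc, c => by
    simp only [CT.toListAux]
    rw [CT.mem_toListAux l (CT.toListAux r acc), CT.mem_toListAux r acc,
      CT.mem_toListAux l (CT.toListAux r [])]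
    tauto

/-- A reified tree asserts that some clause of its flat list is falsified. -/
theorem CT.reify_imp {x : ℕ → Prop} : ∀ (t : CT), CT.reify x t → ∃ c ∈ t.toList, Clause.reify x c
  | .one c, h => ⟨c, List.mem_cons_self, h⟩
  | .node l r, h => by
    rcases h with h | h
    · obtain ⟨c, hc, hr⟩ := CT.reify_imp l h
      refine ⟨c, ?_, hr⟩
      rw [CT.toList, CT.toListAux, CT.mem_toListAux]
      exact Or.inl hc
    · obtain ⟨c, hc, hr⟩ := CT.reify_imp r h
      refine ⟨c, ?_, hr⟩
      rw [CT.toList, CT.toListAux, CT.mem_toListAux]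
      exact Or.inr hc

/-- **Soundness of the mirror.** A clause tree refuted in the `lrat_proof` shape has no Boolean model. -/
theorem CT.eval_false_of_propUnsat {t : CT} (h : t.PropUnsat) (x : ℕ → Bool) : t.toList.eval x = false := by
  obtain ⟨c, hc, hcr⟩ := CT.reify_imp t (h fun v => x v = true)
  have hlits := Clause.reify_imp hcr
  have hcf : c.eval x = false := by
    rw [Clause.eval, List.any_eq_false]
    intro l hl
    have hr := hlits l hl
    cases l with
    | pos v => simpa [Lit.reify, Lit.eval] using hr
    | neg v =>
      simp only [Lit.reify] at hr
      simp [Lit.eval, hr]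
  rw [CNF.eval, List.all_eq_false]
  exact ⟨c, hc, by simp [hcf]⟩

end Summit.Ventures.MM22.ProfileSAT

namespace Summit.Ventures.MM22.ProfileSAT

/-! ## 4. DIMACS rendering (evaluated at elaboration time only, as the first argument of `from_lrat`) -/

/-- DIMACS text of a literal. -/
def Lit.dimacs : Lit → String
  | .pos v => toString (v + 1)
  | .neg v => "-" ++ toString (v + 1)

/-- DIMACS text of a clause body (terminated by `0`). -/
def Clause.dimacs (c : Clause) : String :=
  c.foldl (fun s l => s ++ l.dimacs ++ " ") "" ++ "0"

/-- DIMACS text of a CNF with `nv` variables. -/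
def CNF.dimacs (nv : ℕ) (f : CNF) : String :=
  f.foldl (fun s c => s ++ " " ++ c.dimacs) ("p cnf " ++ toString nv ++ " " ++ toString f.length)

end Summit.Ventures.MM22.ProfileSAT

namespace Summit.Ventures.MM22.ProfileSAT

/-! ## 5. Compact literal codes for data files (`2v ↦ pos v`, `2v+1 ↦ neg v`) -/

/-- Decode a literal code. -/
def Lit.ofCode (c : ℕ) : Lit := if c % 2 = 0 then .pos (c / 2) else .neg (c / 2)

/-- Decode a CNF given as literal codes. -/
def CNF.ofCodes (l : List (List ℕ)) : CNF := l.map fun c => c.map Lit.ofCode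

/-- DIMACS text of a clause tree with `nv` variables (evaluated at elaboration time only). -/
def CT.dimacs (nv : ℕ) (t : CT) : String := t.toList.dimacs nv

end Summit.Ventures.MM22.ProfileSAT
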